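import Summits.AtomisticToContinuum.BoseEinsteinCondensation.Theses.BECVortexSheetPeierls
import Literature.Probability.LatticeModels.VillainTorusLongRangeOrder
import Literature.Probability.LatticeModels.VillainTorusWormRepresentation
import HarnessLib

/-!
# `HomogeneousVillainLRO` (route BECVortexSheetPeierls, item stmt-AtomisticToContinuum-13470)

Block long-range order of the homogeneous isotropic 3-D Villain current model on the torus at large
stiffness: there are `K₀, c > 0` such that for all `L ≥ 1` and `β ≥ K₀`,
`ofReal(c·L⁶) ≤ Σ_{x,y ∈ (ℤ/L)³} G((x,0),(y,0))` for
`VillainCurrentModel.homogeneous (fun _ => β) : VillainCurrentModel 3 L 1`.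

Proof: by the worm representation (`VillainCurrentModel.twoPoint_homogeneous_eq_ofReal_pairExpect`)
each `G((x,0),(y,0))` is the Villain-rotator correlation `⟨cos(θ_{(x,0)} − θ_{(y,0)})⟩_{v_β}` on the
torus bond system, which is `≥ 1/2` for `β ≥ β₁(3)` whenever `x, y` are projections of lattice points
at squared distance `< L²/16` (`villain_torus_pairExpect_cosDiff_ge`, Garban–Spencer 2022 run on the
torus with the Villain weight). Restricting the double sum to the injectively projected sub-box
`{0,…,⌊L/8⌋}³` (pairwise `16‖x−y‖² ≤ 48⌊L/8⌋² < L²`) gives `Σ ≥ ½ (⌊L/8⌋+1)⁶ ≥ L⁶/(2·8⁶)`.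
-/

noncomputable section

namespace Summit.AtomisticToContinuum.BoseEinsteinCondensation.Theorems

open MeasureTheory Finset
open scoped BigOperators ENNReal
open Literature.Probability.LatticeModels Literature.Probability.LatticeModels.JCurrent

/-- Arithmetic of the sub-box side `n = ⌊L/8⌋`: `48 n² < L²` and `L⁶ ≤ 8⁶ (n+1)⁶` (`L ≥ 1`). [folklore] -/
theorem subBox_arith {L : ℕ} (hL : 0 < L) :
    48 * ((L / 8 : ℕ) : ℝ) ^ 2 < (L : ℝ) ^ 2 ∧ (L : ℝ) ^ 6 ≤ 8 ^ 6 * (((L / 8 : ℕ) : ℝ) + 1) ^ 6 ∧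
      2 * (L / 8) < L := by
  set n : ℕ := L / 8 with hn
  have h1 : 8 * n ≤ L := Nat.mul_div_le L 8
  have h2 : L < 8 * n + 8 := by
    have := Nat.div_add_mod L 8
    have := Nat.mod_lt L (by norm_num : 0 < 8)
    omega
  have hL' : (0 : ℝ) < L := by exact_mod_cast hL
  have h1' : 8 * (n : ℝ) ≤ L := by exact_mod_cast h1
  have h2' : (L : ℝ) ≤ 8 * ((n : ℝ) + 1) := by
    have : (L : ℝ) < 8 * n + 8 := by exact_mod_cast h2
    linarith
  refine ⟨by nlinarith, ?_, by omega⟩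
  calc (L : ℝ) ^ 6 ≤ (8 * ((n : ℝ) + 1)) ^ 6 := pow_le_pow_left₀ hL'.le h2' 6
    _ = 8 ^ 6 * ((n : ℝ) + 1) ^ 6 := by ring

/-- **`HomogeneousVillainLRO`** (item stmt-AtomisticToContinuum-13470 of route BECVortexSheetPeierls):
long-range order of the homogeneous isotropic 3-D Villain current model on the torus, block-sum form,
uniformly in `L`, for `β ≥ K₀`. [cite: GarbanSpencer2022, Theorem 1.3 with Remark 1 and Remark 10] -/
theorem HomogeneousVillainLRO_proof :
    Summit.AtomisticToContinuum.BoseEinsteinCondensation.Theses.BECVortexSheetPeierls.HomogeneousVillainLRO := by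
  letI : MeasurableSpace Circle := borel Circle
  haveI : BorelSpace Circle := ⟨rfl⟩
  obtain ⟨β₁, hβ₁, H⟩ := villain_torus_pairExpect_cosDiff_ge (d := 3) le_rfl
  refine ⟨β₁, 1 / (2 * 8 ^ 6), by positivity, ?_⟩
  intro L _ β hβ hK
  have hL : 0 < L := Nat.pos_of_ne_zero (NeZero.ne L)
  obtain ⟨h48, hpow, h2n⟩ := subBox_arith hL
  set n : ℕ := L / 8 with hn
  -- the sub-box `{0,…,n}³` and its injective projection
  set C : Finset (Site 3) := Fintype.piFinset fun _ : Fin 3 => Finset.Icc (0 : ℤ) n with hC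
  have hmemC : ∀ z ∈ C, ∀ i, 0 ≤ z i ∧ z i ≤ n := fun z hz i => by
    have := (Fintype.mem_piFinset.1 hz) i
    exact Finset.mem_Icc.1 this
  have hcardC : C.card = (n + 1) ^ 3 := by
    rw [hC, Fintype.card_piFinset, Finset.prod_const, Finset.card_univ, Fintype.card_fin, Int.card_Icc,
      sub_zero, show ((n : ℤ) + 1) = ((n + 1 : ℕ) : ℤ) by push_cast; rfl, Int.toNat_natCast]
  have hCbox : C ⊆ box 3 n := fun z hz => by
    rw [mem_box]
    intro i
    have := hmemC z hz i
    constructor <;> linarith [this.1, this.2]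
  have hinjC : Set.InjOn (Torus.proj (d := 3) L) (C : Set (Site 3)) :=
    (torusProj_injOn_box_of_lt h2n).mono (Finset.coe_subset.2 hCbox)
  -- pairs of points of the sub-box are close
  have hclose : ∀ x ∈ C, ∀ y ∈ C, 16 * ∑ i, ((x i : ℝ) - (y i : ℝ)) ^ 2 < (L : ℝ) ^ 2 := by
    intro x hx y hy
    have hterm : ∀ i, ((x i : ℝ) - (y i : ℝ)) ^ 2 ≤ (n : ℝ) ^ 2 := by
      intro i
      have hxi := hmemC x hx i
      have hyi := hmemC y hy i
      have h1 : ((x i : ℝ) - (y i : ℝ)) ≤ n := by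
        have : x i - y i ≤ n := by linarith [hxi.2, hyi.1]
        exact_mod_cast this
      have h2 : -(n : ℝ) ≤ ((x i : ℝ) - (y i : ℝ)) := by
        have : -(n : ℤ) ≤ x i - y i := by linarith [hxi.1, hyi.2]
        exact_mod_cast this
      nlinarith [abs_le.2 ⟨h2, h1⟩, sq_abs ((x i : ℝ) - (y i : ℝ))]
    have hsum : ∑ i, ((x i : ℝ) - (y i : ℝ)) ^ 2 ≤ 3 * (n : ℝ) ^ 2 := by
      calc ∑ i, ((x i : ℝ) - (y i : ℝ)) ^ 2 ≤ ∑ _i : Fin 3, (n : ℝ) ^ 2 := Finset.sum_le_sum fun i _ => hterm i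
        _ = 3 * (n : ℝ) ^ 2 := by simp
    linarith
  -- the two-point function on projected pairs is at least `1/2`
  set P : VillainCurrentModel 3 L 1 := VillainCurrentModel.homogeneous (fun _ => β) (fun _ => hβ) with hP
  have hhalf : ∀ x ∈ C, ∀ y ∈ C,
      ENNReal.ofReal (1 / 2) ≤ P.twoPoint (Torus.proj L x, 0) (Torus.proj L y, 0) := by
    intro x hx y hy
    rw [hP, VillainCurrentModel.twoPoint_homogeneous_eq_ofReal_pairExpect hβ]
    exact ENNReal.ofReal_le_ofReal (H β hK L 1 x y (hclose x hx y hy))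
  -- restrict the double sum to the projected sub-box
  set e : Site 3 × Site 3 → TorusSite 3 L × TorusSite 3 L := fun q => (Torus.proj L q.1, Torus.proj L q.2) with he
  have heinj : Set.InjOn e ((C ×ˢ C : Finset (Site 3 × Site 3)) : Set (Site 3 × Site 3)) := by
    rintro ⟨a, b⟩ hab ⟨a', b'⟩ hab' h
    simp only [Finset.coe_product, Set.mem_prod, Finset.mem_coe] at hab hab'
    simp only [he, Prod.mk.injEq] at h
    exact Prod.ext (hinjC hab.1 hab'.1 h.1) (hinjC hab.2 hab'.2 h.2)
  have heinj' : ∀ q ∈ C ×ˢ C, ∀ q' ∈ C ×ˢ C, e q = e q' → q = q' := fun q hq q' hq' h =>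
    heinj (Finset.mem_coe.2 hq) (Finset.mem_coe.2 hq') h
  have s1 : ENNReal.ofReal (1 / (2 * 8 ^ 6) * (L : ℝ) ^ 6) ≤ ENNReal.ofReal (((C ×ˢ C).card : ℝ) * (1 / 2)) := by
    refine ENNReal.ofReal_le_ofReal ?_
    rw [Finset.card_product, hcardC]
    push_cast
    nlinarith [hpow]
  have s2 : ENNReal.ofReal (((C ×ˢ C).card : ℝ) * (1 / 2)) = ∑ _q ∈ C ×ˢ C, ENNReal.ofReal (1 / 2) := by
    rw [Finset.sum_const, nsmul_eq_mul, ENNReal.ofReal_mul (Nat.cast_nonneg _), ENNReal.ofReal_natCast]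
  have s3 : ∑ _q ∈ C ×ˢ C, ENNReal.ofReal (1 / 2) ≤ ∑ q ∈ C ×ˢ C, P.twoPoint ((e q).1, 0) ((e q).2, 0) := by
    refine Finset.sum_le_sum fun q hq => ?_
    rw [Finset.mem_product] at hq
    exact hhalf q.1 hq.1 q.2 hq.2
  have s4 : ∑ q ∈ C ×ˢ C, P.twoPoint ((e q).1, 0) ((e q).2, 0) =
      ∑ p ∈ (C ×ˢ C).image e, P.twoPoint (p.1, 0) (p.2, 0) :=
    (Finset.sum_image (f := fun p : TorusSite 3 L × TorusSite 3 L => P.twoPoint (p.1, 0) (p.2, 0)) heinj').symm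
  have s5 : ∑ p ∈ (C ×ˢ C).image e, P.twoPoint (p.1, 0) (p.2, 0) ≤
      ∑ p : TorusSite 3 L × TorusSite 3 L, P.twoPoint (p.1, 0) (p.2, 0) :=
    Finset.sum_le_sum_of_subset (Finset.subset_univ _)
  have s6 : ∑ p : TorusSite 3 L × TorusSite 3 L, P.twoPoint (p.1, 0) (p.2, 0) =
      ∑ x : TorusSite 3 L, ∑ y : TorusSite 3 L, P.twoPoint (x, 0) (y, 0) :=
    Fintype.sum_prod_type _
  calc ENNReal.ofReal (1 / (2 * 8 ^ 6) * (L : ℝ) ^ 6)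
      ≤ ENNReal.ofReal (((C ×ˢ C).card : ℝ) * (1 / 2)) := s1
    _ = ∑ _q ∈ C ×ˢ C, ENNReal.ofReal (1 / 2) := s2
    _ ≤ ∑ q ∈ C ×ˢ C, P.twoPoint ((e q).1, 0) ((e q).2, 0) := s3
    _ = ∑ p ∈ (C ×ˢ C).image e, P.twoPoint (p.1, 0) (p.2, 0) := s4
    _ ≤ ∑ p : TorusSite 3 L × TorusSite 3 L, P.twoPoint (p.1, 0) (p.2, 0) := s5
    _ = ∑ x : TorusSite 3 L, ∑ y : TorusSite 3 L, P.twoPoint (x, 0) (y, 0) := s6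

end Summit.AtomisticToContinuum.BoseEinsteinCondensation.Theorems
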